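import Summits.ValiantsHypothesis.ValiantsHypothesis.Theorems.LacunarySymmetroidMatrixDescartesDoorA26WallBubblingNullEndTwenty

/-!
# `DoorA26` / line `wall_bubbling` — THE TOUCH LIFT in real-exponent currency: touches + alternations ⇒ the support is in the twenty-locus

HONEST FRAMING.  Object-search cell `pub-symmetroid`, crux `Theses.LacunarySymmetroid.DoorA26` (stmt-ValiantsHypothesis-19979; OPEN, typed,
never asserted).  W2 seat val-sym-door-p1 g17.  Def-free helper for obligation (R) of the line `Cruxes/DoorA26/Lines/wall_bubbling.lean`
(interior accumulation: closure points of the twenty-locus must be members): the MULTIPLICITY residual left by W2 g16's #42b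
(`mem_twentyLocus_of_nullBot/nullTop/nullNull_alternations` treat a null END letter; here the colliding zeros are INTERIOR touches of the cone).

THE TOUCH LIFT (`mem_twentyLocus_of_insideTouches_alternations`).  Let `P(t) = Σ_l e^{δ_l t} S_l` be a real symmetric `2 × 2` pencil with
arbitrary real exponents `δ` and let `τ₀ < ⋯ < τ₂₀` be log-time abscissae carrying «virtual signs» `κ_j`: at an abscissa with `det P(τ_j) ≠ 0`
the virtual sign is `det P(τ_j)` itself; at an abscissa with `det P(τ_j) = 0 ≠ tr P(τ_j)` (an INSIDE TOUCH of the light cone: a rank-one point)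
the virtual sign is any negative number.  If the virtual signs alternate strictly, then `δ ∈ Bubbling.TwentyLocus`: the same-support pencil with
the TRACE-SHIFTED letters `S_l − ν·tr(S_l)·1` has determinant `det P − ν(1−ν)·tr² P` (`det_expPencil_traceShift`), which is `< 0` at every touch for
`0 < ν < 1` and keeps the sign of `det P(τ_j)` elsewhere for `ν` small (finitely many continuity conditions, `exists_traceShift_signs`); the `21`
alternating values give `20` log-time zeros (W2 #42b `le_ncard_of_alternations_exp`) and `Census.RealExp.ncard_rpow_eq_ncard_exp` converts to the
locus' `x^δ` currency.  The OUTSIDE twin (`mem_twentyLocus_of_outsideTouches_alternations`: virtual sign positive at touches, shift `S_l + ν·tr(S_l)·1`,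
determinant `det P + ν(1+ν)·tr² P`) treats touches of the cone from the space-like side.
READING.  (i) With all ten odd abscissae touches this is the `TenTouches` lift of `Theorems/DoorA26/Negative/DoorA26FalseOfTenTouches.lean`
(val-sym-door-p1 g13) in the line's real-exponent currency and WITHOUT the all-touch restriction: any mixture «k inside touches + (20 − 2k) simple
zeros in alternating position» is a member of the twenty-locus.  (ii) For (R): a single-cluster limit of twenties at an interior point whose colliding
zeros are all touches of ONE type (inside or outside) is not an obstruction to `stub_chamberRigidity` — it is a member.  Mixed-type touch profiles and
zeros of multiplicity ≥ 3 are NOT treated here.  Nothing in this file bears on `DoorA26`, `DoorA34`, `MatrixDescartes` (stmt-ValiantsHypothesis-18050)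
or `VP ≠ VNP`; registers `ζ_sym(2,6) ∈ {18,19,20}` unchanged.

[folklore] `det(M − c·1) = det M − c·tr M + c²` for `2 × 2` matrices, continuity, intermediate value theorem (tree lemmas); [this work] the packaging.
-/

-- `Summit.ValiantsHypothesis.ValiantsHypothesis.…` repeats a component by the D-0017 layout
-- (single-conjunct summit), which the `dupNamespace` linter flags; the name is mandated.
set_option linter.dupNamespace false

namespace Summit.ValiantsHypothesis.ValiantsHypothesis.Theorems.LacunarySymmetroidMatrixDescartes.WallBubbling

open Finset Filter Topology
open Bubbling (TwentyLocus)
open Census.RealExp (ncard_rpow_eq_ncard_exp)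

/-! ## §1 The trace shift of a `2 × 2` pencil with real exponents -/

/-- `det(M − c·1) = det M − c·tr M + c²` for a real `2 × 2` matrix and any scalar `c`. [folklore] -/
theorem det_sub_smul_one_fin_two (M : Matrix (Fin 2) (Fin 2) ℝ) (c : ℝ) :
    (M - c • (1 : Matrix (Fin 2) (Fin 2) ℝ)).det = M.det - c * M.trace + c ^ 2 := by
  rw [Matrix.det_fin_two, Matrix.det_fin_two, Matrix.trace_fin_two]
  simp [Matrix.sub_apply, Matrix.smul_apply]
  ring

/-- A symmetric matrix minus a scalar matrix is symmetric. [folklore] -/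
theorem isSymm_sub_smul_one {n : ℕ} (M : Matrix (Fin n) (Fin n) ℝ) (hM : M.IsSymm) (c : ℝ) :
    (M - c • (1 : Matrix (Fin n) (Fin n) ℝ)).IsSymm := by
  unfold Matrix.IsSymm at hM ⊢
  rw [Matrix.transpose_sub, Matrix.transpose_smul, Matrix.transpose_one, hM]

/-- Evaluating the exponential pencil of the trace-shifted letters `S_l − (ν·tr S_l)·1`:
`Σ_l e^{δ_l t}(S_l − ν tr(S_l)·1) = P(t) − (ν·tr P(t))·1`. [folklore] -/
theorem expPencil_traceShift (δ : Fin 6 → ℝ) (S : Fin 6 → Matrix (Fin 2) (Fin 2) ℝ) (ν t : ℝ) :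
    (∑ l, Real.exp (δ l * t) • (S l - (ν * (S l).trace) • (1 : Matrix (Fin 2) (Fin 2) ℝ)))
      = (∑ l, Real.exp (δ l * t) • S l)
          - (ν * (∑ l, Real.exp (δ l * t) • S l).trace) • (1 : Matrix (Fin 2) (Fin 2) ℝ) := by
  rw [Matrix.trace_sum]
  simp only [smul_sub, Finset.sum_sub_distrib, Matrix.trace_smul, smul_eq_mul, Finset.mul_sum, Finset.sum_smul,
    smul_smul]
  congr 1
  refine Finset.sum_congr rfl fun l _ => ?_
  ring_nf

/-- Determinant of the trace-shifted exponential pencil: `det P(t) − ν(1−ν)·tr² P(t)`. [folklore] -/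
theorem det_expPencil_traceShift (δ : Fin 6 → ℝ) (S : Fin 6 → Matrix (Fin 2) (Fin 2) ℝ) (ν t : ℝ) :
    (∑ l, Real.exp (δ l * t) • (S l - (ν * (S l).trace) • (1 : Matrix (Fin 2) (Fin 2) ℝ))).det
      = (∑ l, Real.exp (δ l * t) • S l).det - ν * (1 - ν) * (∑ l, Real.exp (δ l * t) • S l).trace ^ 2 := by
  rw [expPencil_traceShift, det_sub_smul_one_fin_two]
  ring

/-! ## §2 Choosing the shift: finitely many sign conditions -/

/-- **Sign bookkeeping of the trace shift.**  Finitely many abscissae with «virtual signs» `κ_j` (`= D_j` where `D_j ≠ 0`; any negative number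
where `D_j = 0 ≠ T_j`): for some `0 < ν < 1` every shifted value `D_j − ν(1−ν)T_j²` has the sign of `κ_j`. [folklore] -/
theorem exists_traceShift_signs {N : ℕ} (D T κ : Fin N → ℝ)
    (hκ : ∀ j, (D j ≠ 0 ∧ κ j = D j) ∨ (D j = 0 ∧ T j ≠ 0 ∧ κ j < 0)) :
    ∃ ν : ℝ, 0 < ν ∧ ν < 1 ∧ ∀ j, 0 < κ j * (D j - ν * (1 - ν) * T j ^ 2) := by
  -- each condition holds for all small positive `ν`
  have hev : ∀ j, ∀ᶠ ν in 𝓝[>] (0 : ℝ), 0 < κ j * (D j - ν * (1 - ν) * T j ^ 2) := by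
    intro j
    rcases hκ j with ⟨hD, hk⟩ | ⟨hD, hT, hk⟩
    · -- non-touch: continuity at `ν = 0`, where the value is `D_j² > 0`
      have hcont : Continuous fun ν : ℝ => κ j * (D j - ν * (1 - ν) * T j ^ 2) := by fun_prop
      have h0 : (0 : ℝ) < κ j * (D j - 0 * (1 - 0) * T j ^ 2) := by
        rw [hk]; have := mul_self_pos.mpr hD; nlinarith
      have h1 : ∀ᶠ ν in 𝓝 (0 : ℝ), 0 < κ j * (D j - ν * (1 - ν) * T j ^ 2) :=
        (hcont.tendsto 0).eventually_const_lt h0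
      exact h1.filter_mono nhdsWithin_le_nhds
    · -- touch: for `0 < ν < 1` the value is `−κ_j·ν(1−ν)·T_j² > 0`
      have hmem : Set.Ioo (0 : ℝ) 1 ∈ 𝓝[>] (0 : ℝ) := Ioo_mem_nhdsGT zero_lt_one
      filter_upwards [hmem] with ν hν
      rw [hD]
      have hT2 : 0 < T j ^ 2 := by positivity
      have h1 : 0 < ν * (1 - ν) := mul_pos hν.1 (by linarith [hν.2])
      nlinarith [mul_pos h1 hT2]
  have hall : ∀ᶠ ν in 𝓝[>] (0 : ℝ), (0 < ν ∧ ν < 1) ∧ ∀ j, 0 < κ j * (D j - ν * (1 - ν) * T j ^ 2) := by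
    refine (Filter.Eventually.and ?_ (Filter.eventually_all.2 hev))
    filter_upwards [Ioo_mem_nhdsGT (zero_lt_one' ℝ)] with ν hν
    exact ⟨hν.1, hν.2⟩
  obtain ⟨ν, ⟨hν0, hν1⟩, hν⟩ := hall.exists
  exact ⟨ν, hν0, hν1, hν⟩

/-! ## §3 The touch lift -/

/-- **THE TOUCH LIFT (inside touches).**  Real exponents `δ` (arbitrary), symmetric letters, `21` strictly increasing log-time abscissae `τ` with virtual
signs `κ`: `κ_j = det P(τ_j) ≠ 0`, or `det P(τ_j) = 0 ≠ tr P(τ_j)` (an inside touch of the cone) and `κ_j < 0`.  If the virtual signs alternate strictly,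
then `δ ∈ TwentyLocus` — witnessed by the trace-shifted letters `S_l − ν·tr(S_l)·1`, whose determinant `det P − ν(1−ν)tr²P` takes `21` alternating
non-zero values at `τ`. [this work] -/
theorem mem_twentyLocus_of_insideTouches_alternations (δ : Fin 6 → ℝ) (S : Fin 6 → Matrix (Fin 2) (Fin 2) ℝ)
    (hS : ∀ l, (S l).IsSymm) (τ : Fin 21 → ℝ) (hτ : StrictMono τ) (κ : Fin 21 → ℝ)
    (hκ : ∀ j, ((∑ l, Real.exp (δ l * τ j) • S l).det ≠ 0 ∧ κ j = (∑ l, Real.exp (δ l * τ j) • S l).det) ∨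
      ((∑ l, Real.exp (δ l * τ j) • S l).det = 0 ∧ (∑ l, Real.exp (δ l * τ j) • S l).trace ≠ 0 ∧ κ j < 0))
    (halt : ∀ j : Fin 20, κ j.castSucc * κ j.succ < 0) :
    δ ∈ TwentyLocus := by
  obtain ⟨ν, -, -, hν⟩ := exists_traceShift_signs
    (fun j => (∑ l, Real.exp (δ l * τ j) • S l).det) (fun j => (∑ l, Real.exp (δ l * τ j) • S l).trace) κ hκ
  set S' : Fin 6 → Matrix (Fin 2) (Fin 2) ℝ := fun l => S l - (ν * (S l).trace) • (1 : Matrix (Fin 2) (Fin 2) ℝ) with hS'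
  have hval : ∀ j, (∑ l, Real.exp (δ l * τ j) • S' l).det
      = (∑ l, Real.exp (δ l * τ j) • S l).det - ν * (1 - ν) * (∑ l, Real.exp (δ l * τ j) • S l).trace ^ 2 :=
    fun j => det_expPencil_traceShift δ S ν (τ j)
  have halt' : ∀ j : Fin 20,
      (∑ l, Real.exp (δ l * τ j.castSucc) • S' l).det * (∑ l, Real.exp (δ l * τ j.succ) • S' l).det < 0 := by
    intro j
    rw [hval, hval]
    exact NullEnd.neg_of_sign_transfer (hν j.castSucc) (hν j.succ) (halt j)
  refine ⟨S', fun l => isSymm_sub_smul_one (S l) (hS l) _, ?_⟩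
  rw [ncard_rpow_eq_ncard_exp]
  exact (le_ncard_of_alternations_exp δ S' (by norm_num) τ hτ halt').2

/-- **THE TOUCH LIFT (outside touches).**  Same, with virtual sign POSITIVE at the touches (the cone is touched from the space-like side) and the
shift `S_l + ν·tr(S_l)·1`, determinant `det P + ν(1+ν)tr²P`. [this work] -/
theorem mem_twentyLocus_of_outsideTouches_alternations (δ : Fin 6 → ℝ) (S : Fin 6 → Matrix (Fin 2) (Fin 2) ℝ)
    (hS : ∀ l, (S l).IsSymm) (τ : Fin 21 → ℝ) (hτ : StrictMono τ) (κ : Fin 21 → ℝ)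
    (hκ : ∀ j, ((∑ l, Real.exp (δ l * τ j) • S l).det ≠ 0 ∧ κ j = (∑ l, Real.exp (δ l * τ j) • S l).det) ∨
      ((∑ l, Real.exp (δ l * τ j) • S l).det = 0 ∧ (∑ l, Real.exp (δ l * τ j) • S l).trace ≠ 0 ∧ 0 < κ j))
    (halt : ∀ j : Fin 20, κ j.castSucc * κ j.succ < 0) :
    δ ∈ TwentyLocus := by
  -- apply the sign bookkeeping to `−κ`, `−D`: `0 < (−κ)(−D − ν(1−ν)T²) = κ (D + ν(1−ν)T²)`; then use the shift `−μ` with `μ(1+μ) = ν(1−ν)`,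
  -- realised directly: the letters `S_l − c·tr(S_l)·1` with `c := −μ`, `μ := ν(1−ν)/(…)` — simpler: shift by `c = −ν'` where `ν'(1+ν') = ν(1−ν)`.
  obtain ⟨ν, hν0, hν1, hν⟩ := exists_traceShift_signs
    (fun j => -(∑ l, Real.exp (δ l * τ j) • S l).det) (fun j => (∑ l, Real.exp (δ l * τ j) • S l).trace) (fun j => -κ j)
    (by
      intro j
      rcases hκ j with ⟨hD, hk⟩ | ⟨hD, hT, hk⟩
      · exact Or.inl ⟨neg_ne_zero.mpr hD, by rw [hk]⟩
      · exact Or.inr ⟨by rw [hD, neg_zero], hT, by linarith⟩)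
  -- the shift parameter `c < 0` with `−c(1−c)… `: we need `c` with `-(c * (1 - c)) = ν * (1 - ν)`, i.e. the letters `S_l − c·tr S_l·1`, `c = −μ`,
  -- `μ(1+μ) = ν(1−ν)`: take `μ := (−1 + √(1 + 4ν(1−ν)))/2 > 0`.
  set a : ℝ := ν * (1 - ν) with ha
  have ha0 : 0 < a := mul_pos hν0 (by linarith)
  set μ : ℝ := (-1 + Real.sqrt (1 + 4 * a)) / 2 with hμ
  have hsq : Real.sqrt (1 + 4 * a) ^ 2 = 1 + 4 * a := Real.sq_sqrt (by linarith)
  have hμa : μ * (1 + μ) = a := by rw [hμ]; nlinarith [hsq]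
  set S' : Fin 6 → Matrix (Fin 2) (Fin 2) ℝ := fun l => S l - ((-μ) * (S l).trace) • (1 : Matrix (Fin 2) (Fin 2) ℝ) with hS'
  have hval : ∀ j, (∑ l, Real.exp (δ l * τ j) • S' l).det
      = (∑ l, Real.exp (δ l * τ j) • S l).det + ν * (1 - ν) * (∑ l, Real.exp (δ l * τ j) • S l).trace ^ 2 := by
    intro j
    rw [hS', det_expPencil_traceShift δ S (-μ) (τ j), ← ha, ← hμa]
    ring
  have hν' : ∀ j, 0 < κ j * ((∑ l, Real.exp (δ l * τ j) • S l).det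
      + ν * (1 - ν) * (∑ l, Real.exp (δ l * τ j) • S l).trace ^ 2) := by
    intro j; have := hν j; nlinarith [this]
  have halt' : ∀ j : Fin 20,
      (∑ l, Real.exp (δ l * τ j.castSucc) • S' l).det * (∑ l, Real.exp (δ l * τ j.succ) • S' l).det < 0 := by
    intro j
    rw [hval, hval]
    exact NullEnd.neg_of_sign_transfer (hν' j.castSucc) (hν' j.succ) (halt j)
  refine ⟨S', fun l => isSymm_sub_smul_one (S l) (hS l) _, ?_⟩
  rw [ncard_rpow_eq_ncard_exp]
  exact (le_ncard_of_alternations_exp δ S' (by norm_num) τ hτ halt').2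

end Summit.ValiantsHypothesis.ValiantsHypothesis.Theorems.LacunarySymmetroidMatrixDescartes.WallBubbling
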